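import Mathlib
import HarnessLib
import Literature.Computability.AlgebraicComplexity.PatternExpressions
import Literature.Combinatorics.SimpleGraph.TreeDecomposition
import Summits.ValiantsHypothesis.ValiantsHypothesis.Theorems.MonotoneRestorationOrbitCompressionQPTwoSortedPassage

/-!
# Route MonotoneRestoration, derived node `NonnegRestorationQP` (stmt-16191) / aside `OrbitCompressionQP`
# (stmt-18332) — addendum to `Theorems/…OrbitCompressionQPTwoSortedPassage.lean`: the Reynolds-free
# route and the SCOPE of the vertex budget (row/column sparsity, not supports)

Helper file (`--supports stmt-ValiantsHypothesis-16191`), def-free.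

CORRECTION OF SCOPE to the module docstring of `…TwoSortedPassage.lean` (its sentence beginning "So in
the SUPPORT regime"): a square-symmetric circuit whose gates have supports of size `≤ m` does NOT in
general compute values in the span of the directed looped homomorphism polynomials `dihom_{E,n}` with `E`
on `≤ m` vertices — the support-theorem route (Dawar–Wilsenach §6; Dawar–Pago–Seppelt 2025 §5) yields
directed patterns of bounded WIDTH (bags = supports) on MANY vertices, and for those the passage to
bipartite patterns is not settled by that file or this one: the Reynolds projection of `dihom_{E,n}` onto
the matrix-symmetric polynomials is `Σ_π ((n - |π|)!/n!) · injhom_{bip(E/π),n}` over all partitions `π`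
of the vertex set of `E`, and quotients raise treewidth.  What the vertex budget `m` DOES cover is the
ROW/COLUMN-SPARSITY regime, and there no Reynolds operator is needed:

* `rows_cols_le_of_mem_span_diHom` — a polynomial in the span of the `dihom_{E,n}`, `E` on `≤ m`
  vertices, has every monomial on `≤ m` rows and `≤ m` columns;
* `mem_span_homPoly_of_mem_span_diHom'` — so for a MATRIX-symmetric such polynomial the refined spanning
  theorem `TwoSortedPassage.mem_span_homPoly_of_rows_cols_le` applies directly (same conclusion as
  `TwoSortedPassage.mem_span_homPoly_of_mem_span_diHom`, edge budget `≤ deg p` kept);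
* `mem_narrowSpan_of_rows_cols_le` — ROW/COLUMN-SPARSE MATRIX-SYMMETRIC POLYNOMIALS HAVE NARROW
  EXPANSIONS: monomials on `≤ r` rows and `≤ s` columns ⇒ `p ∈ span{hom_{F,n} : tw F ≤ r + s - 1}`
  (K1's currency; e.g. `r = s = deg p` recovers the polylog-degree floor `HomSpan.narrowExpansion_of_polylogDegree`
  up to constants, and products `Π_{i ∈ R, j ∈ S}`-supported invariants of high degree are new cases).

The treewidth-regime passage ("directed width `≤ k` ⇒ bipartite width `≤ k'`" for matrix-symmetric
polynomials) stays OPEN, as recorded in `Theorems/…OrbitToNarrowExpressionFalse.lean` and DPS25 p. 45.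
Honest label: scope correction + algebra helper; no stub closed; VP ≠ VNP not moved.
[cite: DawarPagoSeppelt2025, Remark p. 17 and §8 p. 45]
-/

-- `Summit.ValiantsHypothesis.ValiantsHypothesis.…` is the tree's mandated namespace (Sub = Summit).
set_option linter.dupNamespace false

noncomputable section

namespace Summit.ValiantsHypothesis.ValiantsHypothesis.Theorems

namespace TwoSortedPassage

open Literature.Computability.AlgebraicComplexity MvPolynomial

variable {n : ℕ}

/-- **Monomials of a polynomial in the vertex-budget directed span use `≤ m` rows and `≤ m` columns.**
[folklore] -/
theorem rows_cols_le_of_mem_span_diHom {m : ℕ} {p : MvPolynomial (Fin n × Fin n) ℂ}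
    (hdi : p ∈ Submodule.span ℂ {q : MvPolynomial (Fin n × Fin n) ℂ | ∃ (a : ℕ) (E : Multiset (Fin a × Fin a)),
      a ≤ m ∧ q = ∑ h : Fin a → Fin n,
        (E.map fun e => (X (h e.1, h e.2) : MvPolynomial (Fin n × Fin n) ℂ)).prod}) :
    ∀ D ∈ p.support, (D.support.image Prod.fst).card ≤ m ∧ (D.support.image Prod.snd).card ≤ m := by
  classical
  refine Submodule.span_induction (p := fun q _ => ∀ D ∈ q.support,
      (D.support.image Prod.fst).card ≤ m ∧ (D.support.image Prod.snd).card ≤ m) ?_ (by simp)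
    (fun x y _ _ hx hy D hD => ?_) (fun c x _ hx D hD => hx D (support_smul hD)) hdi
  · rintro q ⟨a, E, ha, rfl⟩ D hD
    obtain ⟨h1, h2⟩ := rows_cols_le_of_mem_support_diHom (n := n) E hD
    exact ⟨h1.trans ha, h2.trans ha⟩
  · rcases Finset.mem_union.1 (support_add hD) with h | h
    · exact hx D h
    · exact hy D h

/-- **The passage, Reynolds-free** (same conclusion as `mem_span_homPoly_of_mem_span_diHom`, with the edge
budget `≤ deg p` kept): row/column sparsity of the monomials plus the refined spanning theorem. [folklore] -/
theorem mem_span_homPoly_of_mem_span_diHom' {m : ℕ} (p : MvPolynomial (Fin n × Fin n) ℂ)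
    (hp : ∀ σ τ : Equiv.Perm (Fin n), rename (fun ij : Fin n × Fin n => (σ ij.1, τ ij.2)) p = p)
    (hdi : p ∈ Submodule.span ℂ {q : MvPolynomial (Fin n × Fin n) ℂ | ∃ (a : ℕ) (E : Multiset (Fin a × Fin a)),
      a ≤ m ∧ q = ∑ h : Fin a → Fin n,
        (E.map fun e => (X (h e.1, h e.2) : MvPolynomial (Fin n × Fin n) ℂ)).prod}) :
    p ∈ Submodule.span ℂ {q : MvPolynomial (Fin n × Fin n) ℂ | ∃ (a b : ℕ) (F : Multiset (Fin a × Fin b)),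
      a ≤ m ∧ b ≤ m ∧ Multiset.card F ≤ p.totalDegree ∧ q = homPoly F n ℂ} :=
  mem_span_homPoly_of_rows_cols_le p hp (fun D hD => (rows_cols_le_of_mem_span_diHom hdi D hD).1)
    fun D hD => (rows_cols_le_of_mem_span_diHom hdi D hD).2

/-- **Row/column-sparse matrix-symmetric polynomials have narrow expansions** (K1's currency): if every
monomial of a matrix-symmetric `p` uses `≤ r` rows and `≤ s` columns, `p` lies in the span of the
`hom_{F,n}` over bipartite patterns of treewidth `≤ r + s - 1`. [folklore] -/
theorem mem_narrowSpan_of_rows_cols_le (p : MvPolynomial (Fin n × Fin n) ℂ)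
    (hp : ∀ σ τ : Equiv.Perm (Fin n), rename (fun ij : Fin n × Fin n => (σ ij.1, τ ij.2)) p = p)
    {r s : ℕ} (hr : ∀ D ∈ p.support, (D.support.image Prod.fst).card ≤ r)
    (hs : ∀ D ∈ p.support, (D.support.image Prod.snd).card ≤ s) :
    p ∈ Submodule.span ℂ
      {q : MvPolynomial (Fin n × Fin n) ℂ | ∃ (a b : ℕ) (E : Multiset (Fin a × Fin b)),
        Literature.Combinatorics.SimpleGraph.treewidth
            (SimpleGraph.fromRel fun u v : Fin a ⊕ Fin b =>
              ∃ e ∈ E, u = Sum.inl e.1 ∧ v = Sum.inr e.2) ≤ r + s - 1 ∧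
          q = homPoly E n ℂ} := by
  refine Submodule.span_mono ?_ (mem_span_homPoly_of_rows_cols_le p hp hr hs)
  rintro q ⟨a, b, F, ha, hb, -, rfl⟩
  refine ⟨a, b, F, (Literature.Combinatorics.SimpleGraph.treewidth_le_card_sub_one _).trans ?_, rfl⟩
  simp only [Fintype.card_sum, Fintype.card_fin]
  omega

end TwoSortedPassage

end Summit.ValiantsHypothesis.ValiantsHypothesis.Theorems

end
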